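import Mathlib.Data.Matrix.ColumnRowPartitioned
import Literature.NumberTheory.Transcendental.ZilberFieldGSGC
import Literature.NumberTheory.Transcendental.LocusComponents
import Literature.NumberTheory.Transcendental.GammaIsoTransfer
import Literature.RingTheory.KrullDimension.FibreDimension
import HarnessLib

/-!
# Slices and cosets in `Gᴺ` and the `K`-locus `W = Loc(α, V/K)`: toolkit for Bays–Kirby 2018, Prop. 11.5

M. Bays, J. Kirby, *Pseudo-exponential maps, variants, and quasiminimality*, Algebra & Number
Theory 12 (2018), §11.1. The proof of Prop. 11.5 (GΓC over `K` ⟹ GSΓC over `K`) intersects the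
`K`-locus `W = Loc(α, β/K) ⊆ G^{r+n}` of Def. 11.1 with the members
`U_{M,c} = W ∩ (Λ_{M,c} × 𝔾ₘ^{r+n})` of the family of its linear slices and with horizontal cosets
`𝔾ₐ^{r+n} × c·J` of connected algebraic subgroups `J ≤ 𝔾ₘ^{r+n}`, and feeds the atypical
components of these intersections to the horizontal semiabelian weak Zilber–Pink theorem
(Thm 11.4). This file provides the vocabulary and the dimension counts of that proof (exponential
case, inside a fixed exponential field `F`, in the conventions of `ExpVarieties.lean`,
`GammaFields.lean` and `ZilberGenericClosedness.lean`):

* closed and irreducible closed subsets of `Gᴺ = Fᴺ × (Fˣ)ᴺ` and irreducible components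
  (`IsClosedInG`, `IsIrreducibleInG`, `IsIrredComponentInG`; traces on the torus locus of Zariski
  closed / irreducible closed subsets of `F^{N ⊕ N}`), with `exists_isIrredComponentInG_superset`
  (an irreducible closed subset of a closed `S` lies in an irreducible component of `S`);
* connected algebraic subgroups `(ker M)° ≤ 𝔾ₘᴺ` presented by integer matrices (§2.2 and
  Lemma 2.1 of the source) through the saturated row lattice `rowSat M`; the horizontal cosets
  `cosetU c M = 𝔾ₐᴺ × c·(ker M)°`; the linear slices `linSlice W A k = W ∩ Gᴺ ∩ {A x = k}`; their
  closedness in `Gᴺ` (`isClosedInG_linSlice_inter_cosetU`);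
* `WeakZPBound F N W 𝓗` — the CONCLUSION of Thm 11.4 for `S = 𝔾ₘᴺ`, `U = 𝔾ₐᴺ` and the family of
  linear slices of `W`, for a given finite set `𝓗` of integer matrices. This is a predicate: the
  theorem itself (for every Zariski closed `W` such an `𝓗` exists) is the deep input of Prop. 11.5
  and is NOT asserted in this file;
* the ideal `𝔭 = I_{K₀}({α} × V)` of `W = Loc(α, V/K)` (`GammaField.kLocIdeal`;
  `GammaField.locOver K α V = Z_F(𝔭)` definitionally), its primality, the substitution
  `f ↦ f(α, ·)` (`GammaField.substPt`), the bound `dim K₀[X] ⧸ 𝔭 ≤ td(α/K₀) + n` (source,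
  display (11.3); `GammaField.exists_ringKrullDim_quotient_kLocIdeal_le`), the dimension drop on
  proper `K₀`-closed subsets such as slices (`GammaField.zariskiDim_add_one_le_of_notMem`), the
  dimension `td(ζ/K₀)` of the `K₀`-locus of a point
  (`GammaField.exists_ringKrullDim_quotient_vanishingIdeal_singleton`) and
  `td(α/K₀) + (n - rk M) ≤ td(ζ/K₀)` (display (11.1); `GammaField.relRank_gammaPt_add_le`);
* bookkeeping: the rows of a relation matrix span all rational relations
  (`mem_span_rows_of_isRelation`), ranks of stacked matrices (`rank_fromRows_eq_of_mem_span`),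
  Laurent monomials constant on a component of a base change take their value in the algebraically
  closed small field (`LocusComponents.mem_range_of_prod_zpow_eq_const`), row forms and coset
  binomials over `K₀`, arithmetic of dimensions in `WithBot ℕ∞`.

The proof of Prop. 11.5 from these, the fibre-dimension theorem (`MonomialFibreDimension.lean`)
and the weak Zilber–Pink bound is `ZilberProp115.lean`.

## References

* M. Bays, J. Kirby, *Pseudo-exponential maps, variants, and quasiminimality*, Algebra & Number
  Theory 12 (2018) 493–549: §2.2, Lemma 2.1, Def. 11.1, Thm 11.4, Prop. 11.5 (proof, displays
  (11.1)–(11.4)).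
-/

noncomputable section

open Set MvPolynomial

universe u

namespace Literature.NumberTheory.Transcendental

/-! ### Closed and irreducible subsets of `Gᴺ = 𝔾ₐᴺ × 𝔾ₘᴺ`, irreducible components -/

section Components

variable (F : Type*) [Field F] (N : ℕ)

/-- `S ⊆ Gᴺ(F) = Fᴺ × (Fˣ)ᴺ` is *closed in `Gᴺ`*: the trace on the torus locus of a Zariski
closed subset of `F^{N ⊕ N}`. [folklore] -/
def IsClosedInG (S : Set (Fin N ⊕ Fin N → F)) : Prop :=
  ∃ Sc : Set (Fin N ⊕ Fin N → F), IsZariskiClosed F Sc ∧ S = Sc ∩ torusLocus F N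

/-- `X ⊆ Gᴺ(F)` is an *irreducible closed subset of `Gᴺ`*: a non-empty trace `Xc ∩ Gᴺ` of an
irreducible Zariski closed `Xc ⊆ F^{N ⊕ N}` (these are the irreducible closed subsets of the
Zariski open `Gᴺ ⊆ F^{N ⊕ N}`, `Xc` being the closure of `X`). [folklore] -/
def IsIrreducibleInG (X : Set (Fin N ⊕ Fin N → F)) : Prop :=
  ∃ Xc : Set (Fin N ⊕ Fin N → F), IsIrreducibleClosed F Xc ∧ X = Xc ∩ torusLocus F N ∧ X.Nonempty

/-- `X` is an *irreducible component* of `S ⊆ Gᴺ(F)`: an irreducible closed subset of `Gᴺ`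
contained in `S` and maximal among such. [folklore] -/
def IsIrredComponentInG (S X : Set (Fin N ⊕ Fin N → F)) : Prop :=
  IsIrreducibleInG F N X ∧ X ⊆ S ∧
    ∀ Y : Set (Fin N ⊕ Fin N → F), IsIrreducibleInG F N Y → X ⊆ Y → Y ⊆ S → Y = X

variable {F N}

/-- **`Xc ∩ Gᴺ` is dense in `Xc`** for `Xc` with prime vanishing ideal meeting `Gᴺ`: a polynomial
vanishing on `Xc ∩ Gᴺ` vanishes on `Xc` (multiply by `∏ Yᵢ`). [folklore] -/
theorem vanishingIdeal_inter_torusLocus {Xc : Set (Fin N ⊕ Fin N → F)}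
    (hprime : (vanishingIdeal F Xc).IsPrime) (hne : (Xc ∩ torusLocus F N).Nonempty) :
    vanishingIdeal F (Xc ∩ torusLocus F N) = vanishingIdeal F Xc := by
  refine le_antisymm ?_ (vanishingIdeal_anti_mono inter_subset_left)
  intro a ha
  have h1 : a * ∏ i, X (Sum.inr i) ∈ vanishingIdeal F Xc := by
    rw [mem_vanishingIdeal_iff]
    intro z hz
    by_cases hzT : z ∈ torusLocus F N
    · rw [map_mul, (mem_vanishingIdeal_iff.1 ha) z ⟨hz, hzT⟩, zero_mul]
    · simp only [mem_torusLocus_iff, not_forall, not_not] at hzT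
      obtain ⟨i, hi⟩ := hzT
      rw [map_mul, map_prod]
      simp only [aeval_X]
      rw [Finset.prod_eq_zero (Finset.mem_univ i) hi, mul_zero]
  have hprod : (∏ i, X (Sum.inr i) : MvPolynomial (Fin N ⊕ Fin N) F) ∉ vanishingIdeal F Xc := by
    obtain ⟨z, hz, hzT⟩ := hne
    intro h
    have := (mem_vanishingIdeal_iff.1 h) z hz
    rw [map_prod] at this
    simp only [aeval_X] at this
    exact (Finset.prod_ne_zero_iff.2 fun i _ => hzT i) this
  exact (hprime.mem_or_mem h1).resolve_right hprod

/-- The vanishing ideal of an irreducible closed subset of `Gᴺ` is that of its closure, hence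
prime. [folklore] -/
theorem IsIrreducibleInG.vanishingIdeal_eq {X Xc : Set (Fin N ⊕ Fin N → F)}
    (hXc : IsIrreducibleClosed F Xc) (hX : X = Xc ∩ torusLocus F N) (hne : X.Nonempty) :
    vanishingIdeal F X = vanishingIdeal F Xc := by
  rw [hX] at hne ⊢
  exact vanishingIdeal_inter_torusLocus hXc.2 hne

/-- A Zariski closed set is the zero set of its vanishing ideal. [folklore] -/
theorem IsZariskiClosed.zeroLocus_vanishingIdeal {ι : Type*} {W : Set (ι → F)}
    (hW : IsZariskiClosed F W) : zeroLocus F (vanishingIdeal F W) = W := by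
  obtain ⟨I, rfl⟩ := hW
  exact le_antisymm (zeroLocus_anti_mono (le_vanishingIdeal_zeroLocus I))
    (zeroLocus_vanishingIdeal_le _)

/-- The dimension of an irreducible closed subset of `Gᴺ` is that of its closure. [folklore] -/
theorem zariskiDim_inter_torusLocus {Xc : Set (Fin N ⊕ Fin N → F)}
    (hprime : (vanishingIdeal F Xc).IsPrime) (hne : (Xc ∩ torusLocus F N).Nonempty) :
    zariskiDim F (Xc ∩ torusLocus F N) = zariskiDim F Xc := by
  unfold zariskiDim
  rw [vanishingIdeal_inter_torusLocus hprime hne]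

variable [IsAlgClosed F]

/-- **Irreducible closed subsets of `Gᴺ` lie in irreducible components.** If `S` is closed in
`Gᴺ` and `X ⊆ S` is an irreducible closed subset of `Gᴺ`, then some irreducible component of `S`
contains `X` (take a minimal prime of `I(S)` below the prime `I(X)`). [folklore] -/
theorem exists_isIrredComponentInG_superset {S X : Set (Fin N ⊕ Fin N → F)}
    (hS : IsClosedInG F N S) (hX : IsIrreducibleInG F N X) (hXS : X ⊆ S) :
    ∃ X' : Set (Fin N ⊕ Fin N → F), IsIrredComponentInG F N S X' ∧ X ⊆ X' := by
  obtain ⟨Sc, hSc, hSeq⟩ := hS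
  obtain ⟨Xc, hXc, hXeq, hXne⟩ := hX
  -- the prime `𝔭 = I(X) = I(Xc)` contains `I(S)`
  have hIX : vanishingIdeal F X = vanishingIdeal F Xc := by
    have hne' : (Xc ∩ torusLocus F N).Nonempty := by rw [← hXeq]; exact hXne
    rw [hXeq]; exact vanishingIdeal_inter_torusLocus hXc.2 hne'
  haveI hprime : (vanishingIdeal F X).IsPrime := by rw [hIX]; exact hXc.2
  have hle : vanishingIdeal F S ≤ vanishingIdeal F X := vanishingIdeal_anti_mono hXS
  obtain ⟨𝔮, h𝔮min, h𝔮le⟩ := Ideal.exists_minimalPrimes_le hle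
  haveI h𝔮 : 𝔮.IsPrime := h𝔮min.1.1
  refine ⟨zeroLocus F 𝔮 ∩ torusLocus F N, ⟨?_, ?_, ?_⟩, ?_⟩
  · -- irreducible, non-empty
    refine ⟨zeroLocus F 𝔮, isIrreducibleClosed_zeroLocus 𝔮, rfl, ?_⟩
    obtain ⟨x, hx⟩ := hXne
    refine ⟨x, ?_, ?_⟩
    · have hx' : x ∈ zeroLocus F (vanishingIdeal F X) := zeroLocus_vanishingIdeal_le X hx
      exact zeroLocus_anti_mono h𝔮le hx'
    · rw [hXeq] at hx; exact hx.2
  · -- contained in `S`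
    rintro z ⟨hz, hzT⟩
    have h1 : z ∈ zeroLocus F (vanishingIdeal F S) := zeroLocus_anti_mono h𝔮min.1.2 hz
    have h2 : zeroLocus F (vanishingIdeal F S) ⊆ Sc := by
      rw [← hSc.zeroLocus_vanishingIdeal]
      refine zeroLocus_anti_mono (vanishingIdeal_anti_mono ?_)
      rw [hSeq]; exact inter_subset_left
    rw [hSeq]
    exact ⟨h2 h1, hzT⟩
  · -- maximal
    rintro Y ⟨Yc, hYc, hYeq, hYne⟩ hXY hYS
    have hIY : vanishingIdeal F Y = vanishingIdeal F Yc := by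
      rw [hYeq] at hYne ⊢; exact vanishingIdeal_inter_torusLocus hYc.2 hYne
    -- `I(S) ≤ I(Y) ≤ I(Z(𝔮) ∩ G) = 𝔮`, so `I(Y) = 𝔮` by minimality
    have hne𝔮 : (zeroLocus F 𝔮 ∩ torusLocus F N).Nonempty := by
      obtain ⟨x, hx⟩ := hXne
      refine ⟨x, zeroLocus_anti_mono h𝔮le (zeroLocus_vanishingIdeal_le X hx), ?_⟩
      rw [hXeq] at hx; exact hx.2
    have hI𝔮 : vanishingIdeal F (zeroLocus F 𝔮 ∩ torusLocus F N) = 𝔮 := by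
      rw [vanishingIdeal_inter_torusLocus _ hne𝔮, MvPolynomial.IsPrime.vanishingIdeal_zeroLocus 𝔮]
      rw [MvPolynomial.IsPrime.vanishingIdeal_zeroLocus 𝔮]; infer_instance
    have h1 : vanishingIdeal F Y ≤ 𝔮 := by
      rw [← hI𝔮]; exact vanishingIdeal_anti_mono hXY
    have h2 : vanishingIdeal F S ≤ vanishingIdeal F Y := vanishingIdeal_anti_mono hYS
    haveI : (vanishingIdeal F Y).IsPrime := by rw [hIY]; exact hYc.2
    have heq : vanishingIdeal F Y = 𝔮 := le_antisymm h1 (h𝔮min.2 ⟨inferInstance, h2⟩ h1)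
    apply le_antisymm
    · intro y hy
      refine ⟨?_, by rw [hYeq] at hy; exact hy.2⟩
      have : y ∈ Yc := by rw [hYeq] at hy; exact hy.1
      have hy' : y ∈ zeroLocus F (vanishingIdeal F Yc) := by
        rw [hYc.1.zeroLocus_vanishingIdeal]; exact this
      rw [← hIY, heq] at hy'
      exact hy'
    · exact hXY
  · -- `X ⊆ Z(𝔮) ∩ G`
    intro x hx
    refine ⟨zeroLocus_anti_mono h𝔮le (zeroLocus_vanishingIdeal_le X hx), ?_⟩
    rw [hXeq] at hx; exact hx.2

end Components

/-! ### Torus cosets `𝔾ₐᴺ × c·(ker M)°` and linear slices of a family -/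

section Cosets

variable (N : ℕ)

/-- The saturation of the row lattice of an integer matrix `M`: the integer vectors a non-zero
multiple of which is an integer combination of the rows of `M`. The connected component of the
identity of the algebraic subgroup `ker [M] = {y ∈ 𝔾ₘᴺ | y^M = 1}` is
`(ker M)° = {y | y^m = 1 for all m in the saturation}` (Bays–Kirby 2018, §2.2 and Lemma 2.1:
every connected algebraic subgroup of `𝔾ₘᴺ` is of this form). [cite: BaysKirby2018ANT, §2.2 and Lemma 2.1] -/
def rowSat (M : Matrix (Fin N) (Fin N) ℤ) : Set (Fin N → ℤ) :=
  {m | ∃ d : ℤ, d ≠ 0 ∧ d • m ∈ Submodule.span ℤ (Set.range fun i : Fin N => M i)}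

variable (F : Type*) [Field F]

/-- The "horizontal" coset `𝔾ₐᴺ × c·(ker M)° ⊆ Gᴺ = 𝔾ₐᴺ × 𝔾ₘᴺ` of the connected algebraic
subgroup `(ker M)°` of `𝔾ₘᴺ` through the torus point `c`: the points `(x, y) ∈ Gᴺ` with
`(y/c)^m = 1` for every `m` in the saturated row lattice of `M`.
[cite: BaysKirby2018ANT, Thm 11.4 (`U × c+J`)] -/
def cosetU (c : Fin N → F) (M : Matrix (Fin N) (Fin N) ℤ) : Set (Fin N ⊕ Fin N → F) :=
  {z | z ∈ torusLocus F N ∧ ∀ m ∈ rowSat N M, ∏ i, (z (Sum.inr i) / c i) ^ m i = 1}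

/-- The member `U_{A,k} = W ∩ (Λ_{A,k} × 𝔾ₘᴺ)` of the family of linear slices of `W ∩ Gᴺ`:
the points `(x, y) ∈ W ∩ Gᴺ` with `A x = k` (Bays–Kirby 2018, proof of Prop. 11.5: "as `M` and
`c` vary, we get the family of all possible affine linear subspaces").
[cite: BaysKirby2018ANT, Prop. 11.5 (proof)] -/
def linSlice (W : Set (Fin N ⊕ Fin N → F)) (A : Matrix (Fin N) (Fin N) F) (k : Fin N → F) :
    Set (Fin N ⊕ Fin N → F) :=
  {z | z ∈ W ∧ z ∈ torusLocus F N ∧ A.mulVec (z ∘ Sum.inl) = k}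

variable {N F}

/-- Membership in `cosetU`. [folklore] -/
theorem mem_cosetU_iff {c : Fin N → F} {M : Matrix (Fin N) (Fin N) ℤ} {z : Fin N ⊕ Fin N → F} :
    z ∈ cosetU N F c M ↔
      z ∈ torusLocus F N ∧ ∀ m ∈ rowSat N M, ∏ i, (z (Sum.inr i) / c i) ^ m i = 1 :=
  Iff.rfl

/-- Membership in `linSlice`. [folklore] -/
theorem mem_linSlice_iff {W : Set (Fin N ⊕ Fin N → F)} {A : Matrix (Fin N) (Fin N) F}
    {k : Fin N → F} {z : Fin N ⊕ Fin N → F} :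
    z ∈ linSlice N F W A k ↔ z ∈ W ∧ z ∈ torusLocus F N ∧ A.mulVec (z ∘ Sum.inl) = k :=
  Iff.rfl

/-- The rows of `M` lie in its saturated row lattice. [folklore] -/
theorem row_mem_rowSat (M : Matrix (Fin N) (Fin N) ℤ) (i : Fin N) : M i ∈ rowSat N M :=
  ⟨1, one_ne_zero, by rw [one_smul]; exact Submodule.subset_span ⟨i, rfl⟩⟩

/-- A torus point lies on its own coset: `c ∈ c·(ker M)°`. [folklore] -/
theorem mem_cosetU_self {z : Fin N ⊕ Fin N → F} (hz : z ∈ torusLocus F N)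
    (M : Matrix (Fin N) (Fin N) ℤ) : z ∈ cosetU N F (z ∘ Sum.inr) M := by
  refine ⟨hz, fun m _ => ?_⟩
  simp only [Function.comp_apply, div_self (hz _), one_zpow, Finset.prod_const_one]

/-- **Cosets are closed in `Gᴺ`**: on the torus, `(y/c)^m = 1` is the polynomial equation
`∏ yᵢ^{mᵢ⁺} ∏ cᵢ^{mᵢ⁻} = ∏ yᵢ^{mᵢ⁻} ∏ cᵢ^{mᵢ⁺}`. [folklore] -/
theorem prod_div_zpow_eq_one_iff {c y : Fin N → F} (hc : ∀ i, c i ≠ 0) (hy : ∀ i, y i ≠ 0)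
    (m : Fin N → ℤ) :
    ∏ i, (y i / c i) ^ m i = 1 ↔
      (∏ i, y i ^ (m i).toNat) * ∏ i, c i ^ (-m i).toNat =
        (∏ i, y i ^ (-m i).toNat) * ∏ i, c i ^ (m i).toNat := by
  have hsplit : ∀ (u : Fin N → F), (∀ i, u i ≠ 0) →
      ∏ i, u i ^ m i = (∏ i, u i ^ (m i).toNat) / ∏ i, u i ^ (-m i).toNat := by
    intro u hu
    rw [← Finset.prod_div_distrib]
    refine Finset.prod_congr rfl fun i _ => ?_
    rw [← zpow_natCast, ← zpow_natCast, ← zpow_sub₀ (hu i), Int.toNat_sub_toNat_neg]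
  have hyc : ∀ i, y i / c i ≠ 0 := fun i => div_ne_zero (hy i) (hc i)
  have h1 : ∏ i, (y i / c i) ^ m i = (∏ i, y i ^ m i) / ∏ i, c i ^ m i := by
    rw [← Finset.prod_div_distrib]
    exact Finset.prod_congr rfl fun i _ => div_zpow _ _ _
  rw [h1, hsplit y hy, hsplit c hc]
  have hy1 : (∏ i, y i ^ (-m i).toNat) ≠ 0 := Finset.prod_ne_zero_iff.2 fun i _ => pow_ne_zero _ (hy i)
  have hc1 : (∏ i, c i ^ (-m i).toNat) ≠ 0 := Finset.prod_ne_zero_iff.2 fun i _ => pow_ne_zero _ (hc i)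
  have hc2 : (∏ i, c i ^ (m i).toNat) ≠ 0 := Finset.prod_ne_zero_iff.2 fun i _ => pow_ne_zero _ (hc i)
  rw [div_div_div_eq, div_eq_one_iff_eq (mul_ne_zero hy1 hc2)]

/-- The binomial over `F` expressing `(y/c)^m = 1` on the torus. [folklore] -/
def cosetBinomial (c : Fin N → F) (m : Fin N → ℤ) : MvPolynomial (Fin N ⊕ Fin N) F :=
  (∏ i, X (Sum.inr i) ^ (m i).toNat) * C (∏ i, c i ^ (-m i).toNat) -
    (∏ i, X (Sum.inr i) ^ (-m i).toNat) * C (∏ i, c i ^ (m i).toNat)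

/-- Evaluating the coset binomial. [folklore] -/
theorem aeval_cosetBinomial (c : Fin N → F) (m : Fin N → ℤ) (z : Fin N ⊕ Fin N → F) :
    aeval z (cosetBinomial c m) =
      (∏ i, z (Sum.inr i) ^ (m i).toNat) * ∏ i, c i ^ (-m i).toNat -
        (∏ i, z (Sum.inr i) ^ (-m i).toNat) * ∏ i, c i ^ (m i).toNat := by
  simp only [cosetBinomial, map_sub, map_mul, map_prod, map_pow, aeval_X, aeval_C]
  rfl

/-- **`U_{A,k} ∩ (𝔾ₐᴺ × c·(ker M)°)` is closed in `Gᴺ`** for `W` Zariski closed and `c` a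
torus point. [folklore] -/
theorem isClosedInG_linSlice_inter_cosetU {W : Set (Fin N ⊕ Fin N → F)} (hW : IsZariskiClosed F W)
    (A : Matrix (Fin N) (Fin N) F) (k : Fin N → F) {c : Fin N → F} (hc : ∀ i, c i ≠ 0)
    (M : Matrix (Fin N) (Fin N) ℤ) :
    IsClosedInG F N (linSlice N F W A k ∩ cosetU N F c M) := by
  obtain ⟨I, rfl⟩ := hW
  -- linear equations and binomials
  let lin : Fin N → MvPolynomial (Fin N ⊕ Fin N) F :=
    fun i => (∑ j, C (A i j) * X (Sum.inl j)) - C (k i)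
  let J : Ideal (MvPolynomial (Fin N ⊕ Fin N) F) :=
    I ⊔ Ideal.span (Set.range lin) ⊔ Ideal.span (cosetBinomial c '' rowSat N M)
  refine ⟨zeroLocus F J, ⟨J, rfl⟩, ?_⟩
  have hlin : ∀ (z : Fin N ⊕ Fin N → F) (i : Fin N),
      aeval z (lin i) = A.mulVec (z ∘ Sum.inl) i - k i := by
    intro z i
    simp only [lin, map_sub, map_sum, map_mul, aeval_C, aeval_X, Matrix.mulVec, dotProduct,
      Function.comp_apply]
    rfl
  ext z
  constructor
  · rintro ⟨⟨hzW, hzT, hzA⟩, -, hzc⟩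
    refine ⟨?_, hzT⟩
    rw [mem_zeroLocus_iff]
    intro p hp
    refine Submodule.mem_sup.1 hp |>.elim fun p₁ ⟨hp₁, p₂, hp₂, hp12⟩ => ?_
    rw [← hp12, map_add]
    have h2 : aeval z p₂ = 0 := by
      refine Submodule.span_induction ?_ (by simp) (fun _ _ _ _ h h' => by rw [map_add, h, h', add_zero])
        (fun a _ _ h => by rw [smul_eq_mul, map_mul, h, mul_zero]) hp₂
      rintro _ ⟨m, hm, rfl⟩
      rw [aeval_cosetBinomial, sub_eq_zero]
      exact (prod_div_zpow_eq_one_iff hc hzT m).1 (hzc m hm)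
    have h1 : aeval z p₁ = 0 := by
      refine Submodule.mem_sup.1 hp₁ |>.elim fun q₁ ⟨hq₁, q₂, hq₂, hq12⟩ => ?_
      rw [← hq12, map_add, (mem_zeroLocus_iff.1 hzW) q₁ hq₁, zero_add]
      refine Submodule.span_induction ?_ (by simp) (fun _ _ _ _ h h' => by rw [map_add, h, h', add_zero])
        (fun a _ _ h => by rw [smul_eq_mul, map_mul, h, mul_zero]) hq₂
      rintro _ ⟨i, rfl⟩
      rw [hlin, hzA, sub_self]
    rw [h1, h2, add_zero]
  · rintro ⟨hzJ, hzT⟩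
    rw [mem_zeroLocus_iff] at hzJ
    have hI : ∀ p ∈ I, aeval z p = 0 := fun p hp =>
      hzJ p (Ideal.mem_sup_left (Ideal.mem_sup_left hp))
    have hA : A.mulVec (z ∘ Sum.inl) = k := by
      funext i
      have := hzJ (lin i) (Ideal.mem_sup_left (Ideal.mem_sup_right (Ideal.subset_span ⟨i, rfl⟩)))
      rwa [hlin, sub_eq_zero] at this
    have hcos : ∀ m ∈ rowSat N M, ∏ i, (z (Sum.inr i) / c i) ^ m i = 1 := by
      intro m hm
      have := hzJ _ (Ideal.mem_sup_right (Ideal.subset_span ⟨m, hm, rfl⟩))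
      rw [aeval_cosetBinomial, sub_eq_zero] at this
      exact (prod_div_zpow_eq_one_iff hc hzT m).2 this
    exact ⟨⟨(mem_zeroLocus_iff.2 hI), hzT, hA⟩, hzT, hcos⟩

end Cosets

/-! ### The conclusion of the horizontal weak Zilber–Pink theorem for the family of `W` -/

section WeakZP

variable (F : Type*) [Field F] (N : ℕ)

/-- **The finite set `𝓗` controls the atypical intersections of the linear slices of `W` with
horizontal cosets** — the conclusion of Bays–Kirby's Theorem 11.4 ("horizontal semiabelian weak
Zilber–Pink") for `S = 𝔾ₘᴺ`, `U = 𝔾ₐᴺ` and the family `(U_{A,k})_{A,k}` of linear slices of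
`W ∩ Gᴺ` (`Literature.NumberTheory.Transcendental.linSlice`), the connected algebraic subgroups
of `𝔾ₘᴺ` being presented as `(ker M)°` by integer matrices (Bays–Kirby 2018, §2.2, Lemma 2.1) with
`dim (ker M)° = N - rk M` and `dim ((ker M_H)° ∩ (ker M_J)°) = N - rk (M_H; M_J)`: for every slice
`U_{A,k}`, every coset `c·(ker M_J)°`, every irreducible component `X` of
`U_{A,k} ∩ (𝔾ₐᴺ × c·(ker M_J)°)` of atypical dimension
(`dim X > dim U_{A,k} + (N + dim J) - 2N`) and every `x = (x₁, x₂) ∈ X`, there is `M_H ∈ 𝓗` with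
`X ⊆ 𝔾ₐᴺ × x₂·(ker M_H)°` and
`dim X ≤ dim (U_{A,k} ∩ (𝔾ₐᴺ × x₂·(ker M_H)°)) + dim (H ∩ J) - dim H`.
[cite: BaysKirby2018ANT, Thm 11.4] -/
def WeakZPBound (W : Set (Fin N ⊕ Fin N → F)) (𝓗 : Finset (Matrix (Fin N) (Fin N) ℤ)) : Prop :=
  ∀ (A : Matrix (Fin N) (Fin N) F) (k : Fin N → F) (MJ : Matrix (Fin N) (Fin N) ℤ) (c : Fin N → F)
    (X : Set (Fin N ⊕ Fin N → F)), (∀ i, c i ≠ 0) →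
    IsIrredComponentInG F N (linSlice N F W A k ∩ cosetU N F c MJ) X →
    zariskiDim F (linSlice N F W A k) + ((N - (MJ.map (Int.cast : ℤ → ℚ)).rank : ℕ) : WithBot ℕ∞) <
      zariskiDim F X + (N : WithBot ℕ∞) →
    ∀ x ∈ X, ∃ MH ∈ 𝓗, X ⊆ cosetU N F (x ∘ Sum.inr) MH ∧
      zariskiDim F X + (((Matrix.fromRows MH MJ).map (Int.cast : ℤ → ℚ)).rank : WithBot ℕ∞) ≤
        zariskiDim F (linSlice N F W A k ∩ cosetU N F (x ∘ Sum.inr) MH) +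
          ((MH.map (Int.cast : ℤ → ℚ)).rank : WithBot ℕ∞)

end WeakZP

/-! ### Finite dimensions in `WithBot ℕ∞` -/

section DimArith

variable {F : Type*} [Field F] {ι : Type*}

/-- A non-empty set has dimension `≥ 0` (its coordinate ring is non-trivial). [folklore] -/
theorem zariskiDim_nonneg_of_nonempty {S : Set (ι → F)} (hS : S.Nonempty) : 0 ≤ zariskiDim F S := by
  unfold zariskiDim
  haveI : Nontrivial (MvPolynomial ι F ⧸ vanishingIdeal F S) := by
    refine Ideal.Quotient.nontrivial_iff.2 ?_
    intro htop
    obtain ⟨w, hw⟩ := hS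
    have : (1 : MvPolynomial ι F) ∈ vanishingIdeal F S := by rw [htop]; trivial
    rw [mem_vanishingIdeal_iff] at this
    simpa using this w hw
  exact ringKrullDim_nonneg_of_nontrivial

/-- An element of `WithBot ℕ∞` between `0` and a natural number is a natural number. [folklore] -/
theorem WithBot.exists_nat_eq_of_le {x : WithBot ℕ∞} (h0 : 0 ≤ x) {d : ℕ} (hd : x ≤ d) :
    ∃ m : ℕ, x = m ∧ m ≤ d := by
  induction x using WithBot.recBotCoe with
  | bot => exact absurd h0 (by simp)
  | coe a =>
    induction a using ENat.recTopCoe with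
    | top =>
      exfalso
      have : ((⊤ : ℕ∞) : WithBot ℕ∞) ≤ (d : ℕ∞) := hd
      rw [WithBot.coe_le_coe] at this
      exact (ENat.coe_lt_top d).not_ge this
    | coe m =>
      refine ⟨m, rfl, ?_⟩
      have : ((m : ℕ∞) : WithBot ℕ∞) ≤ (d : ℕ∞) := hd
      rw [WithBot.coe_le_coe] at this
      exact_mod_cast this

/-- `s < x` in `WithBot ℕ∞` for a natural number `s` gives `s + 1 ≤ x`. [folklore] -/
theorem WithBot.natCast_add_one_le_of_lt {x : WithBot ℕ∞} {s : ℕ} (h : (s : WithBot ℕ∞) < x) :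
    ((s + 1 : ℕ) : WithBot ℕ∞) ≤ x := by
  induction x using WithBot.recBotCoe with
  | bot => exact absurd h (by simp)
  | coe a =>
    have h' : (s : ℕ∞) < a := by
      have : ((s : ℕ∞) : WithBot ℕ∞) < a := h
      exact WithBot.coe_lt_coe.1 this
    have : ((s + 1 : ℕ) : ℕ∞) ≤ a := by
      have := Order.add_one_le_of_lt h'
      exact_mod_cast this
    exact_mod_cast (WithBot.coe_le_coe.2 this)

end DimArith

/-! ### Relation matrices: the row space is the space of all relations -/

section Relations

variable {F : Type*} [Field F] [CharZero F]

open GammaField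

/-- **The rows of a relation matrix span all rational relations.** If the integer matrix `M` has
rank `s`, its rows are `ℚ`-linear relations of `ζ` modulo `Λ`, and `ldim_ℚ(ζ/Λ) + s = N`
(`ZilberGSGC.exists_relation_matrix`), then every rational relation of `ζ` modulo `Λ` lies in the
`ℚ`-row space of `M` (rank–nullity). [folklore] -/
theorem mem_span_rows_of_isRelation (Λ : Submodule ℚ F) {N : ℕ} (ζ : Fin N → F) {s : ℕ}
    {M : Matrix (Fin N) (Fin N) ℤ} (hrank : (M.map (Int.cast : ℤ → ℚ)).rank = s)
    (hrel : ∀ i, ∑ j, (M i j : F) * ζ j ∈ Λ) (hldim : ldim Λ (Submodule.span ℚ (range ζ)) + s = N)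
    {q : Fin N → ℚ} (hq : ∑ j, (q j : F) * ζ j ∈ Λ) :
    q ∈ Submodule.span ℚ (Set.range (M.map (Int.cast : ℤ → ℚ)).row) := by
  classical
  let φ : (Fin N → ℚ) →ₗ[ℚ] F ⧸ Λ := Fintype.linearCombination ℚ (Λ.mkQ ∘ ζ)
  have hφ : ∀ v : Fin N → ℚ, φ v = Λ.mkQ (∑ j, (v j : F) * ζ j) := by
    intro v
    simp only [φ, Fintype.linearCombination_apply, Function.comp_apply, map_sum]
    refine Finset.sum_congr rfl fun j _ => ?_
    rw [← map_smul, Rat.smul_def]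
  have hrange : Module.finrank ℚ (LinearMap.range φ) = ldim Λ (Submodule.span ℚ (range ζ)) := by
    have : LinearMap.range φ = (Submodule.span ℚ (range ζ)).map Λ.mkQ := by
      rw [Fintype.range_linearCombination, Submodule.map_span, ← Set.range_comp]
    rw [ldim, this]
  have hker : Module.finrank ℚ (LinearMap.ker φ) = s := by
    have h := LinearMap.finrank_range_add_finrank_ker φ
    rw [hrange] at h
    simp only [Module.finrank_fintype_fun_eq_card, Fintype.card_fin] at h
    omega
  -- the row space lies in the kernel and has the same dimension
  set RS : Submodule ℚ (Fin N → ℚ) := Submodule.span ℚ (Set.range (M.map (Int.cast : ℤ → ℚ)).row)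
    with hRS
  have hle : RS ≤ LinearMap.ker φ := by
    rw [hRS, Submodule.span_le]
    rintro _ ⟨i, rfl⟩
    rw [SetLike.mem_coe, LinearMap.mem_ker, hφ, Submodule.mkQ_apply, Submodule.Quotient.mk_eq_zero]
    have : ∑ j, (((M.map (Int.cast : ℤ → ℚ)).row i j : ℚ) : F) * ζ j = ∑ j, (M i j : F) * ζ j := by
      refine Finset.sum_congr rfl fun j _ => ?_
      simp [Matrix.row, Matrix.map_apply]
    rw [this]
    exact hrel i
  have hdim : Module.finrank ℚ RS = s := by
    rw [hRS, ← Matrix.rank_eq_finrank_span_row, hrank]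
  have heq : RS = LinearMap.ker φ :=
    Submodule.eq_of_le_of_finrank_eq hle (by rw [hdim, hker])
  have hqker : q ∈ LinearMap.ker φ := by
    rw [LinearMap.mem_ker, hφ, Submodule.mkQ_apply, Submodule.Quotient.mk_eq_zero]
    exact hq
  rw [← heq] at hqker
  exact hqker

/-- **Stacking rows from the row space does not change the rank.** [folklore] -/
theorem rank_fromRows_eq_of_mem_span {N : ℕ} {MH M : Matrix (Fin N) (Fin N) ℤ}
    (h : ∀ i, (MH.map (Int.cast : ℤ → ℚ)) i ∈ Submodule.span ℚ (Set.range (M.map (Int.cast : ℤ → ℚ)).row)) :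
    ((Matrix.fromRows MH M).map (Int.cast : ℤ → ℚ)).rank = (M.map (Int.cast : ℤ → ℚ)).rank := by
  rw [Matrix.rank_eq_finrank_span_row, Matrix.rank_eq_finrank_span_row, Matrix.fromRows_map]
  have hspan : Submodule.span ℚ (Set.range (Matrix.fromRows (MH.map (Int.cast : ℤ → ℚ))
      (M.map (Int.cast : ℤ → ℚ))).row) = Submodule.span ℚ (Set.range (M.map (Int.cast : ℤ → ℚ)).row) := by
    apply le_antisymm
    · rw [Submodule.span_le]
      rintro _ ⟨i, rfl⟩
      rcases i with i | i
      · have : (Matrix.fromRows (MH.map (Int.cast : ℤ → ℚ)) (M.map (Int.cast : ℤ → ℚ))).row (Sum.inl i) =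
            (MH.map (Int.cast : ℤ → ℚ)) i := by
          funext j; simp [Matrix.row, Matrix.fromRows_apply_inl]
        rw [this]
        exact h i
      · have : (Matrix.fromRows (MH.map (Int.cast : ℤ → ℚ)) (M.map (Int.cast : ℤ → ℚ))).row (Sum.inr i) =
            (M.map (Int.cast : ℤ → ℚ)).row i := by
          funext j; simp [Matrix.row, Matrix.fromRows_apply_inr]
        rw [this]
        exact Submodule.subset_span ⟨i, rfl⟩
    · refine Submodule.span_mono ?_
      rintro _ ⟨i, rfl⟩
      refine ⟨Sum.inr i, ?_⟩
      funext j; simp [Matrix.row, Matrix.fromRows_apply_inr]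
  rw [hspan]

end Relations

/-! ### Monomials constant on a component of a base change are constant in the small field -/

section Constants

namespace LocusComponents

variable {k F : Type u} [Field k] [Field F] [Algebra k F] {N : ℕ}
  {P : Ideal (MvPolynomial (Fin N ⊕ Fin N) k)} [P.IsPrime]
  {Q : Ideal (MvPolynomial (Fin N ⊕ Fin N) F)} [Q.IsPrime]

attribute [local instance] MvPolynomial.algebraMvPolynomial

/-- An element of an extension of an algebraically closed field `k` which is algebraic over `k`
lies in `k`. [folklore] -/
theorem mem_range_algebraMap_of_isAlgebraic {E : Type*} [Field E] [Algebra k E] [IsAlgClosed k]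
    {v : E} (hv : IsAlgebraic k v) : v ∈ Set.range (algebraMap k E) := by
  have hint : IsIntegral k v := hv.isIntegral
  haveI := IntermediateField.adjoin.finiteDimensional hint
  have hbot := IntermediateField.eq_bot_of_isAlgClosed_of_isAlgebraic (IntermediateField.adjoin k {v})
  have hmem : v ∈ (⊥ : IntermediateField k E) := hbot ▸ IntermediateField.mem_adjoin_simple_self k v
  rwa [IntermediateField.mem_bot] at hmem

/-- **A Laurent monomial constant on the torus points of a component `Z(Q)` of `Z(P)_F` has its
value in `k`**, for `k` algebraically closed (and `F` algebraically closed, `Z(P)` meeting the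
torus generically): the value is the image in `F(Z(Q))` of the corresponding monomial in the
generic point of `Z(P)` over `k`, which is therefore algebraic over `k` (transcendental elements of
`k(Z(P))` stay transcendental over `F`, `transcendental_funcMap`). [folklore] -/
theorem mem_range_of_prod_zpow_eq_const [IsAlgClosed k] [IsAlgClosed F]
    (hQ : Q ∈ (P.map (algebraMap (MvPolynomial (Fin N ⊕ Fin N) k)
      (MvPolynomial (Fin N ⊕ Fin N) F))).minimalPrimes)
    (hY : ∀ i, (X (Sum.inr i) : MvPolynomial (Fin N ⊕ Fin N) k) ∉ P) (m : Fin N → ℤ) (u : F)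
    (hu : ∀ z ∈ zeroLocus F Q ∩ torusLocus F N, ∏ i, z (Sum.inr i) ^ m i = u) :
    u ∈ Set.range (algebraMap k F) := by
  classical
  have hne : (zeroLocus F Q ∩ torusLocus F N).Nonempty := component_inter_torusLocus_nonempty hQ hY
  have hYQ : ∀ i, (X (Sum.inr i) : MvPolynomial (Fin N ⊕ Fin N) F) ∉ Q := X_inr_notMem_component hQ hY
  -- the binomial `∏ Y^{m⁺} - u ∏ Y^{m⁻}` lies in `Q`
  set p : MvPolynomial (Fin N ⊕ Fin N) F :=
    (∏ i, X (Sum.inr i) ^ (m i).toNat) - C u * ∏ i, X (Sum.inr i) ^ (-m i).toNat with hp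
  have hsplit : ∀ {C : Type u} [Field C] (y : Fin N → C), (∀ i, y i ≠ 0) →
      ∏ i, y i ^ m i = (∏ i, y i ^ (m i).toNat) / ∏ i, y i ^ (-m i).toNat := by
    intro C _ y hy
    rw [← Finset.prod_div_distrib]
    refine Finset.prod_congr rfl fun i _ => ?_
    rw [← zpow_natCast, ← zpow_natCast, ← zpow_sub₀ (hy i), Int.toNat_sub_toNat_neg]
  have hpQ : p ∈ Q := by
    rw [← vanishingIdeal_zeroLocus_inter_torusLocus Q hne, mem_vanishingIdeal_iff]
    rintro z ⟨hz, hzT⟩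
    have h1 := hu z ⟨hz, hzT⟩
    rw [hsplit (fun i => z (Sum.inr i)) hzT, div_eq_iff
      (Finset.prod_ne_zero_iff.2 fun i _ => pow_ne_zero _ (hzT i))] at h1
    simp only [hp, map_sub, map_mul, map_prod, map_pow, aeval_X, aeval_C, Algebra.algebraMap_self,
      RingHom.id_apply]
    rw [h1, sub_self]
  -- read at the generic point of `Z(Q)`
  set E := zeroLocusFunctionField Q with hE
  have hηT : genericPt Q ∈ torusLocus E N := genericPt_mem_torusLocus Q hYQ
  have hη : ∏ i, genericPt Q (Sum.inr i) ^ m i = algebraMap F E u := by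
    have h0 : aeval (genericPt Q) p = 0 := (aeval_genericPt_eq_zero_iff Q p).2 hpQ
    simp only [hp, map_sub, map_mul, map_prod, map_pow, aeval_X, aeval_C, sub_eq_zero] at h0
    rw [hsplit (fun i => genericPt Q (Sum.inr i)) hηT, div_eq_iff
      (Finset.prod_ne_zero_iff.2 fun i _ => pow_ne_zero _ (hηT i)), h0]
  -- the same monomial in the generic point of `Z(P)` over `k`
  set v : zeroLocusFunctionField P := ∏ i, genericPt P (Sum.inr i) ^ m i with hv
  have hfv : funcMap hQ v = algebraMap F E u := by
    rw [hv, map_prod]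
    simp only [map_zpow₀, funcMap_genericPt]
    exact hη
  by_cases halg : IsAlgebraic k v
  · obtain ⟨c, hc⟩ := mem_range_algebraMap_of_isAlgebraic halg
    refine ⟨c, (algebraMap F E).injective ?_⟩
    rw [← hfv, ← hc, funcMap_algebraMap_base]
  · exfalso
    have ht : Transcendental F (funcMap hQ v) := transcendental_funcMap hQ halg
    rw [hfv] at ht
    exact ht (isAlgebraic_algebraMap u)

end LocusComponents

end Constants

namespace GammaField

open Literature.ModelTheory.ExponentialFields.ExponentialRing ZilberGSGC ZilberSaturationMain

/-! ### Substituting `α` into polynomials in `(r + n) + (r + n)` variables -/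

section Subst

variable {k : Type u} [Field k] {E : Type u} [Field E] [Algebra k E] {F : Type u} [Field F]
  [Algebra k F] [Algebra E F] [IsScalarTower k E F] {r n : ℕ}

/-- **Substitution of `α`**: the `k`-algebra map `f ↦ f(α, ·)` from `k[X_{r+n}, Y_{r+n}]` to
`E[X_n, Y_n]`, for `α` with coordinates in `E ⊇ k` (the first blocks of variables are evaluated at
the constants `α`). [folklore] -/
def substPt (α : Fin r ⊕ Fin r → E) :
    MvPolynomial (Fin (r + n) ⊕ Fin (r + n)) k →ₐ[k] MvPolynomial (Fin n ⊕ Fin n) E :=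
  aeval (Sum.elim (Fin.addCases (fun i => C (α (Sum.inl i))) fun i => X (Sum.inl i))
    (Fin.addCases (fun i => C (α (Sum.inr i))) fun i => X (Sum.inr i)))

/-- `f(α, ·)(v) = f(α, v)`. [folklore] -/
theorem aeval_substPt (α : Fin r ⊕ Fin r → E) (f : MvPolynomial (Fin (r + n) ⊕ Fin (r + n)) k)
    (v : Fin n ⊕ Fin n → F) :
    aeval v (substPt (n := n) α f) = aeval (prodPt (algebraMap E F ∘ α) v) f := by
  set w : Fin (r + n) ⊕ Fin (r + n) → MvPolynomial (Fin n ⊕ Fin n) E :=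
    Sum.elim (Fin.addCases (fun i => C (α (Sum.inl i))) fun i => X (Sum.inl i))
      (Fin.addCases (fun i => C (α (Sum.inr i))) fun i => X (Sum.inr i)) with hw_def
  have hw : ∀ j : Fin (r + n) ⊕ Fin (r + n), aeval v (w j) = prodPt (algebraMap E F ∘ α) v j := by
    intro j
    rcases j with (i | i)
    · simp only [hw_def, Sum.elim_inl, prodPt_inl]
      induction i using Fin.addCases with
      | left i => simp
      | right i => simp
    · simp only [hw_def, Sum.elim_inr, prodPt_inr]
      induction i using Fin.addCases with
      | left i => simp
      | right i => simp
  let ψ : MvPolynomial (Fin n ⊕ Fin n) E →ₐ[k] F := (aeval v).restrictScalars k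
  have h := congrArg (fun φ => φ f) (MvPolynomial.comp_aeval (R := k) w ψ)
  simp only [AlgHom.coe_comp, Function.comp_apply] at h
  have hψ : (fun i => ψ (w i)) = prodPt (algebraMap E F ∘ α) v := funext fun j => hw j
  rw [hψ] at h
  exact h

end Subst

/-! ### The ideal `𝔭 = I_{K₀}({α} × V)` of the `K`-locus `W = Loc(α, V/K)` -/

section LocIdeal

variable {F : Type u} [Field F] [CharZero F] [Literature.ModelTheory.ExponentialFields.ExponentialRing F]
  (K : Submodule ℚ F) {n r : ℕ} (a : Fin r → F) (W₀ : Set (Fin n ⊕ Fin n → F))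

/-- **The ideal `𝔭 = I_{K₀}({α} × V)`** over `K₀ = ℚ(K, exp K)` of the points `(α, v)`, `v ∈ V`,
`V = W₀ ∩ Gⁿ`, `α = (a, exp a)`; its `F`-zero set is `W = Loc(α, V/K)` (`GammaField.locOver`).
[cite: BaysKirby2018ANT, Def. 11.1 (`W := Loc(α,β/K)`)] -/
abbrev kLocIdeal : Ideal (MvPolynomial (Fin (r + n) ⊕ Fin (r + n)) (fieldOf K).toSubfield) :=
  vanishingIdeal (fieldOf K).toSubfield (prodPt (gammaPt a) '' (W₀ ∩ torusLocus F n))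

/-- `W = Loc(α, V/K) = Z_F(𝔭)`. [folklore] -/
theorem locOver_eq_zeroLocus_kLocIdeal :
    locOver K (gammaPt a) (W₀ ∩ torusLocus F n) = zeroLocus F (kLocIdeal K a W₀) :=
  rfl

variable {K a W₀}

/-- Membership in `𝔭`: vanishing at all points `(α, v)`, `v ∈ V`. [folklore] -/
theorem mem_kLocIdeal_iff {f : MvPolynomial (Fin (r + n) ⊕ Fin (r + n)) (fieldOf K).toSubfield} :
    f ∈ kLocIdeal K a W₀ ↔ ∀ v ∈ W₀ ∩ torusLocus F n, aeval (prodPt (gammaPt a) v) f = 0 := by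
  rw [kLocIdeal, mem_vanishingIdeal_iff]
  constructor
  · intro h v hv; exact h _ ⟨v, hv, rfl⟩
  · rintro h _ ⟨v, hv, rfl⟩; exact h v hv

/-- **`𝔭` is the pull-back of `I_F(V)` under the substitution `f ↦ f(α, ·)`.** [folklore] -/
theorem kLocIdeal_eq_comap_substPt :
    kLocIdeal K a W₀ = (vanishingIdeal F (W₀ ∩ torusLocus F n)).comap
      (substPt (k := (fieldOf K).toSubfield) (E := F) (n := n) (gammaPt a)) := by
  ext f
  rw [mem_kLocIdeal_iff, Ideal.mem_comap, mem_vanishingIdeal_iff]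
  refine forall₂_congr fun v _ => ?_
  rw [aeval_substPt]
  rfl

/-- **`𝔭` is prime** when `W₀` is irreducible and meets the torus (`I_F(V) = I_F(W₀)` is prime).
[folklore] -/
theorem isPrime_kLocIdeal (hirr : IsIrreducibleClosed F W₀) (hne : (W₀ ∩ torusLocus F n).Nonempty) :
    (kLocIdeal K a W₀).IsPrime := by
  rw [kLocIdeal_eq_comap_substPt]
  haveI : (vanishingIdeal F (W₀ ∩ torusLocus F n)).IsPrime := by
    rw [vanishingIdeal_inter_torusLocus hirr.2 hne]; exact hirr.2
  exact Ideal.IsPrime.comap _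

/-- `Yᵢ ∉ 𝔭` (the points `(α, v)` lie in the torus), provided `V ≠ ∅`. [folklore] -/
theorem X_inr_notMem_kLocIdeal (hne : (W₀ ∩ torusLocus F n).Nonempty) (i : Fin (r + n)) :
    (X (Sum.inr i) : MvPolynomial (Fin (r + n) ⊕ Fin (r + n)) (fieldOf K).toSubfield) ∉
      kLocIdeal K a W₀ := by
  obtain ⟨v, hv⟩ := hne
  rw [mem_kLocIdeal_iff]
  intro h
  have := h v hv
  rw [aeval_X] at this
  exact prodPt_mem_torusLocus (gammaPt_mem_torusLocus a) hv.2 i this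

end LocIdeal

/-! ### The dimension of `W = Loc(α, V/K)`: `dim 𝔭 ≤ td(α/K₀) + n` -/

section LocDim

variable {F : Type u} [Field F] [CharZero F] [Literature.ModelTheory.ExponentialFields.ExponentialRing F]
  {K : Submodule ℚ F} {n r : ℕ} {a : Fin r → F} {W₀ : Set (Fin n ⊕ Fin n → F)}

/-- Transcendence degrees of affine algebras read in `ℕ∞`: an injective algebra map does not
increase them. [folklore] -/
theorem toENat_trdeg_le_of_injective {k : Type u} [Field k] {A B : Type u} [CommRing A] [CommRing B]
    [Algebra k A] [Algebra k B] (f : A →ₐ[k] B) (hf : Function.Injective f) :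
    Cardinal.toENat (Algebra.trdeg k A) ≤ Cardinal.toENat (Algebra.trdeg k B) :=
  OrderHomClass.mono _ (trdeg_le_of_injective f hf)

set_option synthInstance.maxHeartbeats 100000 in
set_option maxHeartbeats 800000 in
/-- **`dim K₀[X] ⧸ 𝔭 ≤ td(α/K₀) + n`** (`W = Loc(α, V/K)` has dimension `td(α/K₀) + dim V`;
Bays–Kirby 2018, proof of Prop. 11.5, display (11.3): "`dim W = dim V + td(α/K)`" — here the
inequality): `K₀[X] ⧸ 𝔭` embeds, by substituting `α`, into the coordinate ring
`L[X_n, Y_n] ⧸ I_L(W₀)` of `W₀` over its field of definition `L = K₀(α)`, whose transcendence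
degree over `K₀` is `trdeg_{K₀} L + trdeg_L = td(α/K₀) + n`.
[cite: BaysKirby2018ANT, Prop. 11.5 (proof, display (11.3))] -/
theorem exists_ringKrullDim_quotient_kLocIdeal_le [IsAlgClosed F] (hirr : IsIrreducibleClosed F W₀)
    (hne : (W₀ ∩ torusLocus F n).Nonempty) (hdim : zariskiDim F W₀ = n)
    (hdef : IsDefinedOver (adjoinPt K a) W₀) :
    ∃ d : ℕ, ringKrullDim (MvPolynomial (Fin (r + n) ⊕ Fin (r + n)) (fieldOf K).toSubfield ⧸
        kLocIdeal K a W₀) = d ∧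
      (d : ℕ∞) ≤ (algMatroid F).relRank ((fieldOf K : Set F)) (range (gammaPt a)) + n := by
  classical
  set K₀ : Subfield F := (fieldOf K).toSubfield with hK₀
  set Sa : Set F := range (gammaPt a) with hSa
  set 𝔭 := kLocIdeal K a W₀ with h𝔭def
  haveI h𝔭 : 𝔭.IsPrime := isPrime_kLocIdeal hirr hne
  -- the field of definition `L = K₀(α)` as an intermediate field over `K₀`
  set Lif : IntermediateField K₀ F := IntermediateField.adjoin K₀ Sa with hLif
  have hSaL : Sa ⊆ (Lif : Set F) := IntermediateField.subset_adjoin K₀ Sa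
  have hle : adjoinPt K a ≤ Lif.toSubfield := by
    rw [adjoinPt, Subfield.closure_le]
    rintro x (hx | hx)
    · have : (⟨x, hx⟩ : K₀) ∈ (Set.univ : Set K₀) := trivial
      exact Lif.algebraMap_mem ⟨x, hx⟩
    · exact hSaL hx
  have hdefL : ∃ J : Ideal (MvPolynomial (Fin n ⊕ Fin n) Lif), W₀ = zeroLocus F J := hdef.of_le hle
  obtain ⟨J, hJ⟩ := hdefL
  -- `R_L = L[X] ⧸ I_L(W₀)`, a domain of dimension `n`
  set IL : Ideal (MvPolynomial (Fin n ⊕ Fin n) Lif) := vanishingIdeal Lif W₀ with hIL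
  haveI hILp : IL.IsPrime := Literature.RingTheory.KrullDimension.isPrime_vanishingIdeal_of_isPrime hirr.2
  haveI : IsDomain (MvPolynomial (Fin n ⊕ Fin n) Lif ⧸ IL) := Ideal.Quotient.isDomain IL
  have hdimRL : ringKrullDim (MvPolynomial (Fin n ⊕ Fin n) Lif ⧸ IL) = n := by
    change ringKrullDim (MvPolynomial (Fin n ⊕ Fin n) Lif ⧸ vanishingIdeal Lif W₀) = n
    rw [← Literature.RingTheory.KrullDimension.ringKrullDim_quotient_vanishingIdeal_eq J hJ hirr.2]
    exact hdim
  have htrRL : Cardinal.toENat (Algebra.trdeg Lif (MvPolynomial (Fin n ⊕ Fin n) Lif ⧸ IL)) = n := by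
    have h1 := Literature.RingTheory.KrullDimension.ringKrullDim_eq_trdeg (↥Lif) (MvPolynomial (Fin n ⊕ Fin n) Lif ⧸ IL)
    rw [hdimRL] at h1
    have h2 : Cardinal.toNat (Algebra.trdeg Lif (MvPolynomial (Fin n ⊕ Fin n) Lif ⧸ IL)) = n := by exact_mod_cast h1.symm
    rw [Literature.RingTheory.KrullDimension.trdeg_eq_toNat (↥Lif) (MvPolynomial (Fin n ⊕ Fin n) Lif ⧸ IL), h2]
    simp
  -- `trdeg_{K₀} L = td(α/K₀)`
  have htrL : Cardinal.toENat (Algebra.trdeg K₀ Lif) = (algMatroid F).relRank (K₀ : Set F) Sa :=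
    toENat_trdeg_adjoin_eq_relRank (fieldOf K) Sa
  -- the tower `K₀ ⊆ L ⊆ R_L`
  haveI : FaithfulSMul K₀ Lif := (faithfulSMul_iff_algebraMap_injective _ _).2 (algebraMap K₀ Lif).injective
  have hinjL : Function.Injective (algebraMap Lif (MvPolynomial (Fin n ⊕ Fin n) Lif ⧸ IL)) := by
    intro x y hxy
    have h1 : Ideal.Quotient.mk IL (C x - C y) = 0 := by
      rw [map_sub, sub_eq_zero]; exact hxy
    rw [Ideal.Quotient.eq_zero_iff_mem, hIL, mem_vanishingIdeal_iff] at h1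
    obtain ⟨v, hv⟩ := hne
    have := h1 v hv.1
    rw [map_sub, aeval_C, aeval_C, sub_eq_zero] at this
    exact (algebraMap Lif F).injective this
  haveI : FaithfulSMul Lif (MvPolynomial (Fin n ⊕ Fin n) Lif ⧸ IL) := (faithfulSMul_iff_algebraMap_injective _ _).2 hinjL
  have htower : Algebra.trdeg K₀ Lif + Algebra.trdeg Lif (MvPolynomial (Fin n ⊕ Fin n) Lif ⧸ IL) = Algebra.trdeg K₀ (MvPolynomial (Fin n ⊕ Fin n) Lif ⧸ IL) :=
    trdeg_add_eq K₀ Lif (A := MvPolynomial (Fin n ⊕ Fin n) Lif ⧸ IL)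
  -- the substitution `Ψ : K₀[X_{r+n}] → R_L`, with kernel `𝔭`
  let αL : Fin r ⊕ Fin r → Lif := fun j => ⟨gammaPt a j, hSaL ⟨j, rfl⟩⟩
  have hαL : (algebraMap Lif F ∘ αL) = gammaPt a := rfl
  let Ψ : MvPolynomial (Fin (r + n) ⊕ Fin (r + n)) K₀ →ₐ[K₀] (MvPolynomial (Fin n ⊕ Fin n) Lif ⧸ IL) :=
    (Ideal.Quotient.mkₐ K₀ IL).comp (substPt (n := n) αL)
  have hkerΨ : RingHom.ker Ψ = 𝔭 := by
    ext f
    rw [RingHom.mem_ker, h𝔭def, mem_kLocIdeal_iff]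
    change Ideal.Quotient.mk IL (substPt (n := n) αL f) = 0 ↔ _
    rw [Ideal.Quotient.eq_zero_iff_mem, hIL]
    -- `I_L(W₀) = I_L(V)` and evaluation of the substituted polynomial
    have hV : vanishingIdeal (↥Lif) W₀ = vanishingIdeal (↥Lif) (W₀ ∩ torusLocus F n) := by
      apply le_antisymm (vanishingIdeal_anti_mono inter_subset_left)
      intro g hg
      have : MvPolynomial.map (algebraMap Lif F) g ∈ vanishingIdeal F W₀ := by
        rw [← vanishingIdeal_inter_torusLocus hirr.2 hne]
        exact Literature.RingTheory.KrullDimension.map_mem_vanishingIdeal hg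
      rw [← Literature.RingTheory.KrullDimension.comap_vanishingIdeal (k := ↥Lif) W₀, Ideal.mem_comap]
      exact this
    rw [hV, mem_vanishingIdeal_iff]
    refine forall₂_congr fun v _ => ?_
    rw [aeval_substPt, hαL]
  -- `K₀[X] ⧸ 𝔭` embeds into `R_L`
  set A := MvPolynomial (Fin (r + n) ⊕ Fin (r + n)) K₀ ⧸ 𝔭 with hA
  haveI : IsDomain A := Ideal.Quotient.isDomain 𝔭
  let Ψ' : A →ₐ[K₀] (MvPolynomial (Fin n ⊕ Fin n) Lif ⧸ IL) := Ideal.Quotient.liftₐ 𝔭 Ψ fun f hf => by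
    rw [← RingHom.mem_ker, hkerΨ]; exact hf
  have hΨ' : Function.Injective Ψ' := by
    rw [injective_iff_map_eq_zero]
    intro x hx
    obtain ⟨f, rfl⟩ := Ideal.Quotient.mk_surjective x
    change Ψ f = 0 at hx
    rw [← RingHom.mem_ker, hkerΨ] at hx
    exact Ideal.Quotient.eq_zero_iff_mem.2 hx
  -- conclusion
  obtain ⟨d, hd, hdt⟩ := Literature.RingTheory.KrullDimension.exists_ringKrullDim_eq_and_trdeg_eq (↥K₀) A
  refine ⟨d, hd, ?_⟩
  have h1 : Cardinal.toENat (Algebra.trdeg K₀ A) ≤ Cardinal.toENat (Algebra.trdeg K₀ (MvPolynomial (Fin n ⊕ Fin n) Lif ⧸ IL)) :=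
    toENat_trdeg_le_of_injective Ψ' hΨ'
  rw [hdt, ← htower, map_add, htrL, htrRL] at h1
  have hK₀coe : (K₀ : Set F) = (fieldOf K : Set F) := rfl
  rw [hK₀coe] at h1
  simpa using h1

end LocDim

/-! ### Dimension drops on proper `k`-closed subsets; the dimension of a `k`-locus of a point -/

section SliceDim

variable {F : Type u} [Field F]

/-- **A `k`-polynomial outside `𝔭` vanishing on `S ⊆ Z_F(𝔭)` makes `dim_F S < dim 𝔭`**: the
`k`-closure of `S` is cut out by an ideal containing `𝔭 + (ℓ)`, and proper quotients of the affine
domain `k[X] ⧸ 𝔭` have smaller dimension. [folklore] -/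
theorem zariskiDim_add_one_le_of_notMem {k : Type u} [Field k] [Algebra k F] {ι : Type} [Finite ι]
    {𝔭 : Ideal (MvPolynomial ι k)} [𝔭.IsPrime] {d : ℕ}
    (hd : ringKrullDim (MvPolynomial ι k ⧸ 𝔭) = d) {S : Set (ι → F)} (hS : S ⊆ zeroLocus F 𝔭)
    {ℓ : MvPolynomial ι k} (hℓ𝔭 : ℓ ∉ 𝔭) (hℓS : ∀ z ∈ S, aeval z ℓ = 0) :
    zariskiDim F S + 1 ≤ d := by
  set I' : Ideal (MvPolynomial ι k) := 𝔭 ⊔ Ideal.span {ℓ} with hI'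
  have hI'le : I' ≤ vanishingIdeal k S := by
    rw [hI', sup_le_iff]
    constructor
    · intro f hf z hz
      exact (mem_zeroLocus_iff.1 (hS hz)) f hf
    · rw [Ideal.span_le, Set.singleton_subset_iff]
      intro z hz
      exact hℓS z hz
  -- `k[X] ⧸ I' ≃ (k[X] ⧸ 𝔭) ⧸ (ℓ̄)`
  set A := MvPolynomial ι k ⧸ 𝔭 with hA
  haveI : IsDomain A := Ideal.Quotient.isDomain 𝔭
  set J : Ideal A := (Ideal.span {ℓ}).map (Ideal.Quotient.mk 𝔭) with hJ
  have hJ0 : J ≠ ⊥ := by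
    intro h0
    have : Ideal.Quotient.mk 𝔭 ℓ ∈ J := Ideal.mem_map_of_mem _ (Ideal.subset_span rfl)
    rw [h0, Ideal.mem_bot, Ideal.Quotient.eq_zero_iff_mem] at this
    exact hℓ𝔭 this
  have e : (A ⧸ J) ≃+* MvPolynomial ι k ⧸ I' := DoubleQuot.quotQuotEquivQuotSup 𝔭 (Ideal.span {ℓ})
  have h1 : zariskiDim F S ≤ ringKrullDim (MvPolynomial ι k ⧸ I') :=
    (Literature.RingTheory.KrullDimension.ringKrullDim_quotient_vanishingIdeal_le (k := k) S).trans
      (ringKrullDim_le_of_surjective (Ideal.Quotient.factor hI'le) (Ideal.Quotient.factor_surjective _))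
  have h2 : ringKrullDim (A ⧸ J) + 1 ≤ ringKrullDim A :=
    Literature.RingTheory.KrullDimension.ringKrullDim_quotient_add_one_le hJ0
  rw [ringKrullDim_eq_of_ringEquiv e] at h2
  have hdA : ringKrullDim A = d := hd
  rw [hdA] at h2
  exact (add_le_add h1 (le_refl (1 : WithBot ℕ∞))).trans h2

variable [CharZero F]

/-- **The dimension of the `K₀`-locus of a point is its transcendence degree**: for a subfield
`K₀ ⊆ F` and a point `ζ ∈ F^ι`, `dim K₀[X] ⧸ I_{K₀}(ζ) = td(ζ/K₀)` (as a relative rank in the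
algebraic matroid of `F/ℚ`). [folklore] -/
theorem exists_ringKrullDim_quotient_vanishingIdeal_singleton (K₀ : Subfield F) {ι : Type}
    [Fintype ι] (ζ : ι → F) :
    ∃ dZ : ℕ, ringKrullDim (MvPolynomial ι K₀ ⧸ vanishingIdeal K₀ ({ζ} : Set (ι → F))) = dZ ∧
      (dZ : ℕ∞) = (algMatroid F).relRank (K₀ : Set F) (range ζ) := by
  classical
  set φ : MvPolynomial ι K₀ →ₐ[K₀] F := aeval ζ with hφ
  have hker : vanishingIdeal K₀ ({ζ} : Set (ι → F)) = RingHom.ker φ := by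
    ext f
    rw [mem_vanishingIdeal_singleton_iff, RingHom.mem_ker]
  haveI : (vanishingIdeal (↥K₀) ({ζ} : Set (ι → F))).IsPrime := by
    rw [hker]; exact RingHom.ker_isPrime _
  set A := MvPolynomial ι K₀ ⧸ vanishingIdeal K₀ ({ζ} : Set (ι → F)) with hA
  haveI : IsDomain A := Ideal.Quotient.isDomain _
  have e : A ≃ₐ[K₀] φ.range :=
    (Ideal.quotientEquivAlgOfEq K₀ (hker.trans (AlgHom.ker_rangeRestrict φ).symm)).trans
      (Ideal.quotientKerAlgEquivOfSurjective (AlgHom.rangeRestrict_surjective φ))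
  have hrange : φ.range = Algebra.adjoin K₀ (range ζ) := (Algebra.adjoin_range_eq_range_aeval K₀ ζ).symm
  obtain ⟨d, hd, hdt⟩ := Literature.RingTheory.KrullDimension.exists_ringKrullDim_eq_and_trdeg_eq (↥K₀) A
  refine ⟨d, hd, ?_⟩
  have h1 : Algebra.trdeg K₀ A = Algebra.trdeg K₀ (Algebra.adjoin K₀ (range ζ)) := by
    rw [e.trdeg_eq, hrange]
  have h2 := ZilberGSGC.toENat_trdeg_adjoin_subfield_eq_relRank K₀ (range ζ)
  rw [← h1, hdt] at h2
  simpa using h2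

variable [Literature.ModelTheory.ExponentialFields.ExponentialRing F]

/-- **`td(α/K₀) + (n - s) ≤ td((α, γ)/K₀)`** for `γ = (g, exp g)` with `ldim_ℚ(g/K + ℚa) = n - s`
and `K + ℚa ◁ F` (Bays–Kirby 2018, proof of Prop. 11.5, display (11.1): `td(ζ/K) = δ(ζ/K) +
ldim(ζ/Γ(K)) ≥ Γdim(α/K) + dim J`): additivity of relative rank and `δ(g/K + ℚa) ≥ 0`.
[cite: BaysKirby2018ANT, Prop. 11.5 (proof, display (11.1))] -/
theorem relRank_gammaPt_add_le (K : Submodule ℚ F) {r n : ℕ} (a : Fin r → F) (g : Fin n → F)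
    (hX : IsStrong (K ⊔ Submodule.span ℚ (range a))) {s : ℕ}
    (hs : ldim (K ⊔ Submodule.span ℚ (range a)) (Submodule.span ℚ (range g)) + s = n) :
    (algMatroid F).relRank ((fieldOf K : Set F)) (range (gammaPt a)) + ((n - s : ℕ) : ℕ∞) ≤
      (algMatroid F).relRank ((fieldOf K : Set F)) (range (gammaPt (Fin.append a g))) := by
  set X : Submodule ℚ F := K ⊔ Submodule.span ℚ (range a) with hXdef
  set K₀ : Subfield F := (fieldOf K).toSubfield with hK₀
  have hK₀coe : (K₀ : Set F) = (fieldOf K : Set F) := rfl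
  set Sa : Set F := range (gammaPt a) with hSa
  have hSp : range (gammaPt (Fin.append a g)) = Sa ∪ range (gammaPt g) := by
    rw [← prodPt_gammaPt, range_prodPt]
  rw [← hK₀coe, hSp]
  have hadd' : (algMatroid F).relRank (K₀ : Set F) Sa +
      (algMatroid F).relRank ((K₀ : Set F) ∪ Sa) (range (gammaPt g)) =
        (algMatroid F).relRank (K₀ : Set F) (Sa ∪ range (gammaPt g)) := by
    rw [← (algMatroid F).relRank_union_self_left (K₀ : Set F) Sa,
      (algMatroid F).relRank_add_relRank' subset_union_left (range (gammaPt g)), union_assoc,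
      (algMatroid F).relRank_union_self_left]
  have htd : ((n - s : ℕ) : ℕ∞) ≤ (algMatroid F).relRank ((K₀ : Set F) ∪ Sa) (range (gammaPt g)) := by
    have hfg : IsFG X (Submodule.span ℚ (range g)) := isFG_span_of_finite X (finite_range g)
    have hδ : 0 ≤ predim X (Submodule.span ℚ (range g)) := (isStrong_iff.1 hX) _ hfg
    rw [predim_def] at hδ
    have h1 : n - s ≤ (td X (Submodule.span ℚ (range g))).toNat := by omega
    rw [hK₀coe, hSa, relRank_fieldOf_union_range_gammaPt K a g, ← ENat.coe_toNat (td_ne_top hfg)]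
    exact_mod_cast h1
  rw [← hadd']
  exact add_le_add le_rfl htd

end SliceDim

/-! ### Row forms, coset binomials, saturated relations -/

section Forms

variable {F : Type u} [Field F] {N : ℕ}

/-- The linear form `∑ⱼ Mᵢⱼ Xⱼ - kᵢ` over a subfield `K₀`. [folklore] -/
def rowForm (K₀ : Subfield F) (M : Matrix (Fin N) (Fin N) ℤ) (kv : Fin N → K₀) (i : Fin N) :
    MvPolynomial (Fin N ⊕ Fin N) K₀ :=
  (∑ j, C ((M i j : ℤ) : K₀) * X (Sum.inl j)) - C (kv i)

/-- Evaluating the row form: `∑ⱼ Mᵢⱼ zⱼ - kᵢ`. [folklore] -/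
theorem aeval_rowForm (K₀ : Subfield F) (M : Matrix (Fin N) (Fin N) ℤ) (kv : Fin N → K₀) (i : Fin N)
    (z : Fin N ⊕ Fin N → F) :
    aeval z (rowForm K₀ M kv i) = (∑ j, (M i j : F) * z (Sum.inl j)) - (kv i : F) := by
  simp only [rowForm, map_sub, map_sum, map_mul, aeval_C, aeval_X]
  congr 1

/-- The binomial `∏ Yᵢ^{mᵢ⁺} - u ∏ Yᵢ^{mᵢ⁻}` over a subfield `K₀`. [folklore] -/
def binomialK (K₀ : Subfield F) (u : K₀) (m : Fin N → ℤ) : MvPolynomial (Fin N ⊕ Fin N) K₀ :=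
  (∏ i, X (Sum.inr i) ^ (m i).toNat) - C u * ∏ i, X (Sum.inr i) ^ (-m i).toNat

/-- Splitting a Laurent monomial into positive and negative parts. [folklore] -/
theorem prod_zpow_eq_div (y : Fin N → F) (hy : ∀ i, y i ≠ 0) (m : Fin N → ℤ) :
    ∏ i, y i ^ m i = (∏ i, y i ^ (m i).toNat) / ∏ i, y i ^ (-m i).toNat := by
  rw [← Finset.prod_div_distrib]
  refine Finset.prod_congr rfl fun i _ => ?_
  rw [← zpow_natCast, ← zpow_natCast, ← zpow_sub₀ (hy i), Int.toNat_sub_toNat_neg]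

/-- On the torus, the binomial vanishes iff the Laurent monomial takes the value `u`. [folklore] -/
theorem aeval_binomialK_eq_zero_iff (K₀ : Subfield F) (u : K₀) (m : Fin N → ℤ) {z : Fin N ⊕ Fin N → F}
    (hz : z ∈ torusLocus F N) :
    aeval z (binomialK K₀ u m) = 0 ↔ ∏ i, z (Sum.inr i) ^ m i = (u : F) := by
  have h1 : aeval z (binomialK K₀ u m) =
      (∏ i, z (Sum.inr i) ^ (m i).toNat) - (u : F) * ∏ i, z (Sum.inr i) ^ (-m i).toNat := by
    simp only [binomialK, map_sub, map_mul, map_prod, map_pow, aeval_X, aeval_C]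
    rfl
  rw [h1, sub_eq_zero, prod_zpow_eq_div _ hz, div_eq_iff
    (Finset.prod_ne_zero_iff.2 fun i _ => pow_ne_zero _ (hz i))]

/-- `∏ (zᵢ/ζᵢ)^{mᵢ} = 1 ↔ ∏ zᵢ^{mᵢ} = ∏ ζᵢ^{mᵢ}` for torus points. [folklore] -/
theorem prod_div_zpow_eq_one_iff_prod_eq {z ζ : Fin N → F} (hζ : ∀ i, ζ i ≠ 0) (m : Fin N → ℤ) :
    ∏ i, (z i / ζ i) ^ m i = 1 ↔ ∏ i, z i ^ m i = ∏ i, ζ i ^ m i := by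
  have : ∏ i, (z i / ζ i) ^ m i = (∏ i, z i ^ m i) / ∏ i, ζ i ^ m i := by
    rw [← Finset.prod_div_distrib]
    exact Finset.prod_congr rfl fun i _ => div_zpow _ _ _
  rw [this, div_eq_one_iff_eq (Finset.prod_ne_zero_iff.2 fun i _ => zpow_ne_zero _ (hζ i))]

end Forms

/-! ### Arithmetic of the atypicality inequality -/

section Arith

/-- The arithmetic of atypicality: `D + 1 ≤ p`, `e ≤ X`, `p + b ≤ e + c` give `D + b < X + c`
in `WithBot ℕ∞` (`D` possibly `⊥`, `X` possibly infinite). [folklore] -/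
theorem WithBot.add_lt_add_of_bounds {D X : WithBot ℕ∞} {p e b c : ℕ}
    (hD : D + 1 ≤ (p : WithBot ℕ∞)) (hX : ((e : ℕ) : WithBot ℕ∞) ≤ X) (h : p + b ≤ e + c) :
    D + (b : WithBot ℕ∞) < X + (c : WithBot ℕ∞) := by
  induction D using WithBot.recBotCoe with
  | bot =>
    rw [WithBot.bot_add]
    refine bot_lt_iff_ne_bot.2 ?_
    intro h0
    have : X + (c : WithBot ℕ∞) ≥ ((e + c : ℕ) : WithBot ℕ∞) := by
      push_cast; exact add_le_add hX le_rfl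
    rw [h0] at this
    exact absurd this (by simp)
  | coe d =>
    induction X using WithBot.recBotCoe with
    | bot => exact absurd hX (by simp)
    | coe x =>
      -- everything in `ℕ∞`
      have hD' : d + 1 ≤ (p : ℕ∞) := by
        have : ((d + 1 : ℕ∞) : WithBot ℕ∞) ≤ (p : ℕ∞) := by exact_mod_cast hD
        exact WithBot.coe_le_coe.1 this
      have hX' : (e : ℕ∞) ≤ x := by
        have : ((e : ℕ∞) : WithBot ℕ∞) ≤ x := by exact_mod_cast hX
        exact WithBot.coe_le_coe.1 this
      have goal : d + (b : ℕ∞) < x + (c : ℕ∞) := by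
        induction d using ENat.recTopCoe with
        | top => exact absurd hD' (by simp)
        | coe d =>
          induction x using ENat.recTopCoe with
          | top => rw [top_add]; exact WithTop.coe_lt_top _
          | coe x =>
            have h1 : d + 1 ≤ p := by exact_mod_cast hD'
            have h2 : e ≤ x := by exact_mod_cast hX'
            have : d + b < x + c := by omega
            exact_mod_cast this
      exact_mod_cast (WithBot.coe_lt_coe.2 goal)

end Arith

end GammaField

end Literature.NumberTheory.Transcendental
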